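import Literature.AlgebraicGeometry.Motives.Sweep1
import Literature.AlgebraicGeometry.Motives.HodgeStructureWeil
import HarnessLib

/-!
# `HodgeRiemannIIStatement B` is a genuine hypothesis on `B`: the conjugate re-decoration of a Betti–Hodge datum

Topic `Literature/AlgebraicGeometry/Motives` (fact seat
`provefact-Literature.AlgebraicGeometry.Motives.Hod-2972f047c8`). The second
Hodge–Riemann bilinear relation `Literature.AlgebraicGeometry.Motives.HodgeRiemannIIStatement B`
of `Motives/Sweep1` (hodge.S15; Voisin, *Hodge Theory I*, Thm. 6.32 (ii); Huybrechts, *Complex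
Geometry*, Prop. 3.3.15: `i^{p-q} (-1)^{k(k-1)/2} ∫ α ∧ ᾱ ∧ ω^{n-k} > 0` for
`0 ≠ α ∈ H^{p,q}(X)_prim`) is a `Prop` PARAMETRISED by a Betti–Hodge realization datum
`B : BettiHodgeData k` (`Motives/BettiRealization`): a HYPOTHESIS STRUCTURE consisting of a Weil
cohomology `B.W`, a comparison with Betti cohomology and, for each smooth projective `X` and each
`i`, SOME pure Hodge structure `B.hodge hX i` of weight `i` on `Hⁱ(X)`, subject only to
(a) pull-backs are morphisms of Hodge structures, (b) each `B.hodge hX i` is polarizable by SOME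
form, (c) cycle classes are Hodge classes. The relation itself is about the FIXED Lefschetz form
`Q(a, b) = tr(a ∪ b ∪ ηʳ)` of `B.W` (`PreWeilCohomology.lefschetzForm`), which (a)–(c) do not
mention. Its would-be discharge `theorem HodgeRiemannIIStatement_holds : ∀ B, HodgeRiemannIIStatement B`
is therefore not what the sources prove (they prove it for THE Hodge structure of `X`), and this
file shows that it does not follow from (a)–(c) — everything here is proved, and the only new
definitions are the standard conjugate re-decorations:

* `HodgeStructure.conjugate H` — the **complex-conjugate Hodge structure** `F^p ↦ conj F^p`
  (`V̄^{p,q} = V^{q,p}`; the axioms of Deligne, Hodge II, 2.1.4 / 1.2.4–1.2.5 are symmetric in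
  `F` and `conj F`), with `piece_conjugate`, `hodgeClasses_conjugate` (Hodge classes unchanged),
  `Hom.conjugate` (same linear map), `Polarization.conjugate` (the transposed form
  `Q.flip = (-1)ⁿ Q` polarizes `H.conjugate`), `IsPolarizable.conjugate`;
* `BettiHodgeData.conjugate B` — same `W`, same comparison, every `B.hodge hX i` replaced by its
  conjugate; (a)–(c) survive by the lemmas above;
* the verdict: the FIRST relation `HodgeRiemannIStatement` cannot see the twist
  (`hodgeRiemannIStatement_conjugate_iff`), but the SECOND acquires the phase `i^{q-p} = -i^{p-q}`
  in odd degree for the same form `Q`, so `HodgeRiemannIIStatement B` and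
  `HodgeRiemannIIStatement B.conjugate` together kill every odd-degree primitive `(p, q)`-class
  (`HodgeRiemannIIStatement.eq_zero_of_conjugate`); as `P¹ = H¹` and the Hodge decomposition
  spans, `∀ B, HodgeRiemannIIStatement B` forces `b₁(X) = 0` for every smooth projective `X` of
  every datum (`finrank_obj_one_eq_zero_of_forall_hodgeRiemannII`,
  `finrank_bettiCohomology_one_eq_zero_of_forall_hodgeRiemannII`), whence
  `¬ ∀ B, HodgeRiemannIIStatement B` as soon as one datum `B : BettiHodgeData k` and one smooth
  projective `X` with `H¹(X(ℂ); ℚ) ≠ 0` exist (`HodgeRiemannIIStatement_not_forall_of_bettiOne`).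
  Classically both exist (the Betti–Hodge realization: Hodge decomposition, Voisin I, Thm. 6.19,
  §7.1, Prop. 11.20; any smooth projective curve of genus `g ≥ 1` has `b₁ = 2g`), but neither is
  constructed in the tree, so they enter as hypotheses — exactly as in the precedent
  `Literature/Barriers/HodgeConjecture/DecompositionOfTheDiagonalWeil.lean`
  (Weil re-decoration `BettiHodgeData.weil`, which in contrast PRESERVES the second relation and
  is useless here).

The closed (datum-free) rendering of the theorem the sources do prove is the harmonic-form fact
`Literature.AlgebraicGeometry.Motives.hodge_riemann_bilinear` (`Motives/HodgeDecomposition`);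
`HodgeRiemannIIStatement B` stays what its docstring says it is — a statement schema about the
classical realization, to be consumed as a hypothesis `(h : HodgeRiemannIIStatement B)`, never
discharged uniformly in `B`.

## References

* C. Voisin, *Hodge Theory and Complex Algebraic Geometry I*, CUP 2002, Thm. 6.32, §7.1.1–7.1.2.
* D. Huybrechts, *Complex Geometry. An Introduction*, Springer 2005, Prop. 3.3.15 (p. 163).
* P. Deligne, *Théorie de Hodge II*, Publ. Math. IHÉS 40 (1971), 1.2.4–1.2.5, 2.1.4, 2.1.15.
* S. Kleiman, *Algebraic cycles and the Weil conjectures* (1968), §1.2 (A), §1.4.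
-/

noncomputable section

open CategoryTheory AlgebraicGeometry
open scoped TensorProduct

namespace Literature.AlgebraicGeometry.Motives

namespace HodgeStructure

universe u v

variable {V : Type u} [AddCommGroup V] [Module ℚ V]
variable {W : Type v} [AddCommGroup W] [Module ℚ W]
variable {n : ℤ}

/-! ### Linear algebra: transposed forms, phases -/

/-- Base change commutes with transposition: `(Qᵗ)_ℂ(x, y) = Q_ℂ(y, x)`. [folklore] -/
theorem flip_baseChange (Q : LinearMap.BilinForm ℚ V) (x y : ℂ ⊗[ℚ] V) :
    Q.flip.baseChange ℂ x y = Q.baseChange ℂ y x := by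
  induction x using TensorProduct.induction_on with
  | zero => simp
  | tmul a v =>
    induction y using TensorProduct.induction_on with
    | zero => simp
    | tmul b w => simp [LinearMap.BilinForm.baseChange_tmul, mul_comm]
    | add y₁ y₂ h₁ h₂ => simp only [map_add, LinearMap.add_apply, h₁, h₂]
  | add x₁ x₂ h₁ h₂ => simp only [map_add, LinearMap.add_apply, h₁, h₂]

/-- `conj (iᵖ) = (iᵖ)⁻¹` (`|i| = 1`). [folklore] -/
theorem conj_I_zpow (p : ℤ) : starRingEnd ℂ (Complex.I ^ p) = (Complex.I ^ p)⁻¹ := by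
  rw [map_zpow₀, Complex.conj_I, ← Complex.inv_I, inv_zpow]

/-- The Hodge–Riemann phase of the swapped type is the conjugate phase:
`conj (i^q (iᵖ)⁻¹) = iᵖ (i^q)⁻¹`. [folklore] -/
theorem conj_I_zpow_mul_inv (p q : ℤ) :
    starRingEnd ℂ (Complex.I ^ q * (Complex.I ^ p)⁻¹) = Complex.I ^ p * (Complex.I ^ q)⁻¹ := by
  rw [map_mul, map_inv₀, conj_I_zpow, conj_I_zpow, inv_inv, mul_comm]

/-- In odd total degree the swapped phase is the opposite phase: for `p - q` odd,
`i^q (iᵖ)⁻¹ = -(iᵖ (i^q)⁻¹)` (both are `i^{∓(p-q)}` and `i^{2(p-q)} = -1`). [folklore] -/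
theorem I_zpow_mul_inv_swap_of_odd {p q : ℤ} (h : Odd (p - q)) :
    Complex.I ^ q * (Complex.I ^ p)⁻¹ = -(Complex.I ^ p * (Complex.I ^ q)⁻¹) := by
  have hu : Complex.I ^ p * (Complex.I ^ q)⁻¹ = Complex.I ^ (p - q) := by
    rw [zpow_sub₀ Complex.I_ne_zero, div_eq_mul_inv]
  have hu' : Complex.I ^ q * (Complex.I ^ p)⁻¹ = (Complex.I ^ (p - q))⁻¹ := by
    rw [zpow_sub₀ Complex.I_ne_zero, inv_div, div_eq_mul_inv]
  have hsq : -(Complex.I ^ (p - q)) * Complex.I ^ (p - q) = 1 := by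
    rw [neg_mul, ← zpow_add₀ Complex.I_ne_zero, ← two_mul, zpow_mul, zpow_ofNat, Complex.I_sq,
      h.neg_one_zpow, neg_neg]
  rw [hu, hu', inv_eq_of_mul_eq_one_left hsq]

/-! ### The conjugate Hodge structure -/

/-- **The complex-conjugate Hodge structure** `H̄` of a pure `ℚ`-Hodge structure `H` of weight
`n`: same `ℚ`-space, Hodge filtration `F̄^p = conj F^p`, i.e. Hodge pieces `V̄^{p,q} = V^{q,p}`
(`piece_conjugate`). It is again a pure Hodge structure of weight `n` because the axioms
(decreasing, finite, `F^p ⊕ conj F^q = V_ℂ` for `p + q = n + 1`) are symmetric under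
`F ↔ conj F` (Deligne, *Théorie de Hodge II*, 1.2.4–1.2.5 and 2.1.4; Voisin I, §7.1.1:
`conj V^{p,q} = V^{q,p}`). [folklore] -/
def conjugate (H : HodgeStructure V n) : HodgeStructure V n where
  F p := complexConj (H.F p)
  antitone_F _ _ h := complexConj_mono (H.antitone_F h)
  exists_F_eq_top := by
    obtain ⟨p, hp⟩ := H.exists_F_eq_top
    exact ⟨p, by rw [hp, complexConj_top]⟩
  exists_F_eq_bot := by
    obtain ⟨p, hp⟩ := H.exists_F_eq_bot
    exact ⟨p, by rw [hp, complexConj_bot]⟩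
  isCompl_F_complexConj p q h := by
    rw [complexConj_complexConj]
    exact (H.isCompl_F_complexConj q p (by omega)).symm

/-- The Hodge filtration of the conjugate structure is the conjugate filtration. [folklore] -/
@[simp]
theorem conjugate_F (H : HodgeStructure V n) (p : ℤ) : H.conjugate.F p = complexConj (H.F p) := rfl

/-- Conjugation of Hodge structures is an involution. [folklore] -/
@[simp]
theorem conjugate_conjugate (H : HodgeStructure V n) : H.conjugate.conjugate = H := by
  ext p x
  simp

/-- The Hodge pieces of the conjugate structure are the swapped pieces: `V̄^{p,q} = V^{q,p}`
(`= conj V^{p,q}`, Voisin I, §7.1.1). [folklore] -/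
theorem piece_conjugate (H : HodgeStructure V n) (p q : ℤ) :
    H.conjugate.piece p q = H.piece q p := by
  by_cases h : p + q = n
  · rw [piece_of_add_eq _ h, piece_of_add_eq _ (show q + p = n by omega), conjugate_F, conjugate_F,
      complexConj_complexConj, inf_comm]
  · rw [piece_eq_bot_of_add_ne _ h, piece_eq_bot_of_add_ne _ (show q + p ≠ n by omega)]

/-- Hodge numbers of the conjugate structure: `h̄^{p,q} = h^{q,p}` (`= h^{p,q}` by Hodge
symmetry). [folklore] -/
theorem hodgeNumber_conjugate (H : HodgeStructure V n) (p q : ℤ) :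
    H.conjugate.hodgeNumber p q = H.hodgeNumber q p := by
  rw [hodgeNumber, hodgeNumber, piece_conjugate]

/-- Conjugation does not change the rational classes of any filtration level (rational vectors
are real: `conj (1 ⊗ v) = 1 ⊗ v`); in particular the Hodge classes `V ∩ V^{p,p}` are the same.
[folklore] -/
@[simp]
theorem hodgeClasses_conjugate (H : HodgeStructure V n) (p : ℤ) :
    H.conjugate.hodgeClasses p = H.hodgeClasses p := by
  ext v
  rw [mem_hodgeClasses_iff, mem_hodgeClasses_iff, conjugate_F, mem_complexConj, conj_ofRat]

/-- A morphism of Hodge structures is, with the same `ℚ`-linear map, a morphism of the conjugate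
structures (its complexification commutes with `conj`). [folklore] -/
def Hom.conjugate {H₁ : HodgeStructure V n} {H₂ : HodgeStructure W n} (f : Hom H₁ H₂) :
    Hom H₁.conjugate H₂.conjugate where
  toLinearMap := f.toLinearMap
  map_F_le p := by
    rintro _ ⟨x, hx, rfl⟩
    change conj (f.toLinearMap.baseChange ℂ x) ∈ H₂.F p
    rw [conj_baseChange]
    exact f.map_F_le p ⟨conj x, hx, rfl⟩

/-- `f.conjugate` has the same underlying linear map as `f`. [folklore] -/
@[simp]
theorem Hom.conjugate_toLinearMap {H₁ : HodgeStructure V n} {H₂ : HodgeStructure W n}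
    (f : Hom H₁ H₂) : f.conjugate.toLinearMap = f.toLinearMap := rfl

/-- **A polarization `Q` of `H` gives the polarization `Qᵗ = (-1)ⁿ Q` of `H̄`.** First relation:
`Qᵗ_ℂ(conj F^p, conj F^{n+1-p}) = conj Q_ℂ(F^{n+1-p}, F^p) = 0`. Second relation: for
`0 ≠ x ∈ V̄^{p,q} = V^{q,p}`, `iᵖ (i^q)⁻¹ Qᵗ_ℂ(x, conj x) = conj (i^q (iᵖ)⁻¹ Q_ℂ(x, conj x))`, the
conjugate of a positive real (Voisin I, §7.1.2, Def. 7.7, read for `H̄`). [folklore] -/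
def Polarization.conjugate {H : HodgeStructure V n} (Q : Polarization H) :
    Polarization H.conjugate where
  form := Q.form.flip
  flip_form := by
    rw [show Q.form.flip.flip = Q.form from LinearMap.ext fun _ => LinearMap.ext fun _ => rfl]
    conv_lhs => rw [← one_smul ℤ Q.form, ← Units.val_one, ← Int.units_mul_self n.negOnePow,
      Units.val_mul, ← smul_smul, ← Q.flip_form]
  form_apply_eq_zero p x hx y hy := by
    have hx' : conj x ∈ H.F (n + 1 - (n + 1 - p)) := by
      rw [show n + 1 - (n + 1 - p) = p by ring]
      exact hx
    have h0 := Q.form_apply_eq_zero (n + 1 - p) (conj y) hy (conj x) hx'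
    rw [form_baseChange_conj, map_eq_zero] at h0
    rw [flip_baseChange, h0]
  pos p q hpq x hx hx0 := by
    rw [piece_conjugate] at hx
    obtain ⟨r, hr, h⟩ := Q.pos q p (by omega) x hx hx0
    refine ⟨r, hr, ?_⟩
    have hc : Q.form.baseChange ℂ (conj x) x = starRingEnd ℂ (Q.form.baseChange ℂ x (conj x)) := by
      have h' := form_baseChange_conj Q.form x (conj x)
      rwa [conj_conj] at h'
    rw [flip_baseChange, hc, ← conj_I_zpow_mul_inv p q, ← map_mul, h, Complex.conj_ofReal]

/-- The form of `Q.conjugate` is the transpose `Qᵗ` (`= (-1)ⁿ Q`). [folklore] -/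
@[simp]
theorem Polarization.conjugate_form {H : HodgeStructure V n} (Q : Polarization H) :
    Q.conjugate.form = Q.form.flip := rfl

/-- The conjugate of a polarizable Hodge structure is polarizable. [folklore] -/
theorem IsPolarizable.conjugate {H : HodgeStructure V n} (h : H.IsPolarizable) :
    H.conjugate.IsPolarizable :=
  h.elim fun Q => ⟨Q.conjugate⟩

end HodgeStructure

/-! ### The conjugate re-decoration of a Betti–Hodge datum -/

namespace BettiHodgeData

variable {k : Type} [Field k] [Algebra k ℂ]

/-- **The conjugate re-decoration of a Betti–Hodge realization datum**: same Weil cohomology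
`W`, same comparison `iso` with Betti cohomology, but every Hodge structure `B.hodge hX i`
replaced by its complex conjugate (`F^p ↦ conj F^p`, `V^{p,q} ↦ V^{q,p}`). The axioms of
`BettiHodgeData` survive: pull-backs remain morphisms (`HodgeStructure.Hom.conjugate`),
polarizability is preserved (`HodgeStructure.IsPolarizable.conjugate`, by the transposed forms),
and Hodge classes are unchanged (`HodgeStructure.hodgeClasses_conjugate`). [folklore] -/
def conjugate (B : BettiHodgeData k) : BettiHodgeData k where
  W := B.W
  iso := B.iso
  iso_cup := B.iso_cup
  iso_one := B.iso_one
  hodge _ _ hX i := (B.hodge hX i).conjugate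
  pullback_hom _ _ hX _ _ hY f i := by
    obtain ⟨φ, hφ⟩ := B.pullback_hom hX hY f i
    exact ⟨φ.conjugate, hφ⟩
  polarizable _ _ hX i := (B.polarizable hX i).conjugate
  cycleClass_mem_hodgeClasses _ _ hX p z hz := by
    rw [HodgeStructure.hodgeClasses_conjugate]
    exact B.cycleClass_mem_hodgeClasses hX p z hz

/-- The conjugate re-decoration keeps the Weil cohomology (and the comparison). [folklore] -/
@[simp]
theorem conjugate_W (B : BettiHodgeData k) : B.conjugate.W = B.W := rfl

/-- The Hodge structures of the conjugate re-decoration are the conjugate structures. [folklore] -/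
theorem conjugate_hodge (B : BettiHodgeData k) {n : ℕ} {X : SchemeOver k}
    (hX : IsSmoothProjective n X) (i : ℕ) : B.conjugate.hodge hX i = (B.hodge hX i).conjugate :=
  rfl

end BettiHodgeData

/-! ### The verdict on `HodgeRiemannIStatement` / `HodgeRiemannIIStatement` -/

section Verdict

variable {k : Type} [Field k] [Algebra k ℂ]

/-- The FIRST Hodge–Riemann relation cannot see the conjugate twist: the Lefschetz form `Q` is
rational, so `Q_ℂ(conj F^p, conj F^{i+1-p}) = conj Q_ℂ(F^p, F^{i+1-p})`. [folklore] -/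
theorem hodgeRiemannIStatement_conjugate_iff (B : BettiHodgeData k) :
    HodgeRiemannIStatement B.conjugate ↔ HodgeRiemannIStatement B := by
  constructor
  · intro h n X hX η hη i r j hr hj p x y hx hy
    have hx' : HodgeStructure.conj x ∈ (B.hodge hX i).conjugate.F p := by
      rw [HodgeStructure.conjugate_F, HodgeStructure.mem_complexConj, HodgeStructure.conj_conj]
      exact hx
    have hy' : HodgeStructure.conj y ∈ (B.hodge hX i).conjugate.F (i + 1 - p) := by
      rw [HodgeStructure.conjugate_F, HodgeStructure.mem_complexConj, HodgeStructure.conj_conj]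
      exact hy
    have h0 : (B.W.lefschetzForm X (n := n) η i r j hj (by omega)).baseChange ℂ
        (HodgeStructure.conj x) (HodgeStructure.conj y) = 0 := h hX hη hr hj p hx' hy'
    rwa [HodgeStructure.form_baseChange_conj, map_eq_zero] at h0
  · intro h n X hX η hη i r j hr hj p x y hx hy
    have h0 : (B.W.lefschetzForm X (n := n) η i r j hj (by omega)).baseChange ℂ
        (HodgeStructure.conj x) (HodgeStructure.conj y) = 0 := h hX hη hr hj p hx hy
    rw [HodgeStructure.form_baseChange_conj, map_eq_zero] at h0
    exact h0

/-- **The second Hodge–Riemann relation for `B` and for `B.conjugate` together kill every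
odd-degree primitive `(p, q)`-class.** For `x ∈ H^{p,q}` (for `B.hodge`), `p + q = i` odd, `x`
primitive: `HodgeRiemannIIStatement B` says `iᵖ (i^q)⁻¹ ε Q_ℂ(x, conj x) > 0`
(`ε = (-1)^{i(i-1)/2}`, `Q` the Lefschetz form of `B.W`), while `x ∈ H̄^{q,p}` for
`B.conjugate`, which has the SAME `W`, `η`, `Q`, so `HodgeRiemannIIStatement B.conjugate` says
`i^q (iᵖ)⁻¹ ε Q_ℂ(x, conj x) > 0`; but `i^q (iᵖ)⁻¹ = -iᵖ (i^q)⁻¹` for `p - q` odd. Hence `x = 0`.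
(Voisin I, Thm. 6.32 (ii) / Huybrechts, Prop. 3.3.15 is a theorem about THE Hodge structure of
`X`; the axioms of `BettiHodgeData` do not tie `B.hodge` to the Lefschetz form of `B.W`.)
[cite: VoisinHodgeI2002, Thm. 6.32] -/
theorem HodgeRiemannIIStatement.eq_zero_of_conjugate {B : BettiHodgeData k}
    (h : HodgeRiemannIIStatement B) (h' : HodgeRiemannIIStatement B.conjugate) {n : ℕ}
    {X : SchemeOver k} (hX : IsSmoothProjective n X) {η : B.W.obj X 2}
    (hη : B.W.IsHyperplaneClass X η) {i r j : ℕ} (hr : i + r = n) (hj : i + 2 * r = j)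
    (hi : Odd i) {p q : ℤ} (hpq : p + q = i) {x : ℂ ⊗[ℚ] B.W.obj X i}
    (hx : x ∈ (B.hodge hX i).piece p q)
    (hprim : x ∈ (B.W.primitivePart X η i (r + 1) (j + 2) (by omega)).baseChange ℂ) : x = 0 := by
  by_contra hx0
  obtain ⟨t, ht, h1⟩ := h hX hη hr hj hpq hx hx0 hprim
  have hx' : x ∈ (B.hodge hX i).conjugate.piece q p := by
    rw [HodgeStructure.piece_conjugate]
    exact hx
  obtain ⟨t', ht', h2⟩ := h' hX hη hr hj (show q + p = (i : ℤ) by omega) hx' hx0 hprim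
  set c : ℂ := (-1 : ℂ) ^ (i.choose 2) *
    (B.W.lefschetzForm X (n := n) η i r j hj (by omega)).baseChange ℂ x (HodgeStructure.conj x)
    with hc
  have h1' : Complex.I ^ p * (Complex.I ^ q)⁻¹ * c = t := by rw [hc, ← mul_assoc]; exact h1
  have h2' : Complex.I ^ q * (Complex.I ^ p)⁻¹ * c = t' := by rw [hc, ← mul_assoc]; exact h2
  have hodd : Odd (p - q) := by
    obtain ⟨m, hm⟩ := hi
    exact ⟨(m : ℤ) - q, by omega⟩
  rw [HodgeStructure.I_zpow_mul_inv_swap_of_odd hodd, neg_mul, h1'] at h2'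
  have htt' : -t = t' := by exact_mod_cast h2'
  linarith

/-- Hence, as soon as some smooth projective `X` of some datum `B` carries a non-zero primitive
`(p, q)`-class in an odd degree `i ≤ dim X` (classically: any curve of genus `≥ 1`, `i = 1`), the
second Hodge–Riemann relation fails for `B` or for `B.conjugate`. [cite: VoisinHodgeI2002, Thm. 6.32] -/
theorem not_hodgeRiemannIIStatement_and_conjugate (B : BettiHodgeData k) {n : ℕ}
    {X : SchemeOver k} (hX : IsSmoothProjective n X) {η : B.W.obj X 2}
    (hη : B.W.IsHyperplaneClass X η) {i r j : ℕ} (hr : i + r = n) (hj : i + 2 * r = j)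
    (hi : Odd i) {p q : ℤ} (hpq : p + q = i) {x : ℂ ⊗[ℚ] B.W.obj X i}
    (hx : x ∈ (B.hodge hX i).piece p q)
    (hprim : x ∈ (B.W.primitivePart X η i (r + 1) (j + 2) (by omega)).baseChange ℂ) (hx0 : x ≠ 0) :
    ¬ (HodgeRiemannIIStatement B ∧ HodgeRiemannIIStatement B.conjugate) :=
  fun h ↦ hx0 (h.1.eq_zero_of_conjugate h.2 hX hη hr hj hi hpq hx hprim)

/-- **`∀ B, HodgeRiemannIIStatement B` forces `b₁ = 0`.** If the second Hodge–Riemann relation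
held for EVERY Betti–Hodge datum over `k`, then `H¹(X) = 0` for every smooth projective `X` of
every datum `B`: for `dim X = 0` by the Weil axiom `Hⁱ = 0`, `i > 2 dim X`; for `dim X ≥ 1` take a
hyperplane class `η` (Weil axiom), note `P¹ = H¹` (`primitivePart_eq_top_of_le_one`), apply
`eq_zero_of_conjugate` to `B` and `B.conjugate` to kill every `H^{p,1-p}`, and use that the Hodge
decomposition spans `H¹_ℂ` (`HodgeStructure.iSup_piece_eq_top_holds`) and
`dim_ℂ H¹_ℂ = dim_ℚ H¹`. [cite: VoisinHodgeI2002, Thm. 6.32] -/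
theorem finrank_obj_one_eq_zero_of_forall_hodgeRiemannII
    (h : ∀ B' : BettiHodgeData k, HodgeRiemannIIStatement B') (B : BettiHodgeData k) {n : ℕ}
    {X : SchemeOver k} (hX : IsSmoothProjective n X) : Module.finrank ℚ (B.W.obj X 1) = 0 := by
  rcases Nat.eq_zero_or_pos n with rfl | hn
  · haveI := B.W.subsingleton_obj hX (i := 1) (by omega)
    exact Module.finrank_zero_of_subsingleton
  obtain ⟨η, hη⟩ := B.W.isHyperplaneClass_nonempty hX hn
  obtain ⟨r, hr⟩ : ∃ r : ℕ, 1 + r = n := ⟨n - 1, by omega⟩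
  have hbot : ∀ p : ℤ, (B.hodge hX 1).piece p (((1 : ℕ) : ℤ) - p) = ⊥ := fun p ↦ by
    rw [Submodule.eq_bot_iff]
    intro x hx
    refine (h B).eq_zero_of_conjugate (h B.conjugate) hX hη hr (j := 1 + 2 * r) rfl odd_one
      (show p + ((1 : ℕ) - p) = ((1 : ℕ) : ℤ) by omega) hx ?_
    rw [B.W.primitivePart_eq_top_of_le_one hX η le_rfl (by omega), Submodule.baseChange_top]
    trivial
  have htop : (⊤ : Submodule ℂ (ℂ ⊗[ℚ] B.W.obj X 1)) = ⊥ := by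
    rw [← HodgeStructure.iSup_piece_eq_top_holds (B.hodge hX 1)]
    exact iSup_eq_bot.2 hbot
  rw [← Module.finrank_baseChange (R := ℂ), ← finrank_top ℂ, htop, finrank_bot]

/-- The same in terms of Betti cohomology: `∀ B, HodgeRiemannIIStatement B` forces
`dim_ℚ H¹(X(ℂ); ℚ) = 0` for every smooth projective `X` of every datum (via the comparison
`B.iso`). [cite: VoisinHodgeI2002, Thm. 6.32] -/
theorem finrank_bettiCohomology_one_eq_zero_of_forall_hodgeRiemannII
    (h : ∀ B' : BettiHodgeData k, HodgeRiemannIIStatement B') (B : BettiHodgeData k) {n : ℕ}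
    {X : SchemeOver k} (hX : IsSmoothProjective n X) :
    Module.finrank ℚ (bettiCohomology X 1) = 0 := by
  rw [← (B.isoObj X 1).finrank_eq]
  exact finrank_obj_one_eq_zero_of_forall_hodgeRiemannII h B hX

/-- **Non-dischargeability of `HodgeRiemannIIStatement`.** Given ONE Betti–Hodge datum
`B : BettiHodgeData k` and ONE smooth projective `X` with `H¹(X(ℂ); ℚ) ≠ 0` (classically: the
Betti–Hodge realization, and any smooth projective curve of genus `g ≥ 1`, `b₁ = 2g`), the
universal closure `∀ B, HodgeRiemannIIStatement B` — the would-be `HodgeRiemannIIStatement_holds`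
— is false. `HodgeRiemannIIStatement B` is a hypothesis on `B` (a statement about the classical
realization, Voisin I, Thm. 6.32 (ii)), not a consequence of the axioms of `BettiHodgeData`.
[cite: VoisinHodgeI2002, Thm. 6.32] -/
theorem HodgeRiemannIIStatement_not_forall_of_bettiOne (B : BettiHodgeData k) {n : ℕ}
    {X : SchemeOver k} (hX : IsSmoothProjective n X) (hb : Nontrivial (bettiCohomology X 1)) :
    ¬ ∀ B' : BettiHodgeData k, HodgeRiemannIIStatement B' := by
  intro h
  haveI : Module.Finite ℚ (B.W.obj X 1) := B.W.finite_obj hX 1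
  haveI : Module.Finite ℚ (bettiCohomology X 1) :=
    Module.Finite.of_surjective (B.isoObj X 1).toLinearMap (B.isoObj X 1).surjective
  exact Module.finrank_pos.ne' (finrank_bettiCohomology_one_eq_zero_of_forall_hodgeRiemannII h B hX)

end Verdict

end Literature.AlgebraicGeometry.Motives

end
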